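import Literature.Algebra.Module.LagrangianSubmodulesSplitPairing
import Literature.Algebra.Module.SymplecticTorsionModulesDVR
import HarnessLib

/-!
# Lagrangian submodules of a split rank-four torsion pairing over a DVR, II: Howard's pairing
# `[x, y] = ⟨x_f, y_tr⟩`, the invariant `δ`, and the transfer of Proposition 1.5.9
# (Howard 2004, Lemmas 1.5.7–1.5.8 and Prop. 1.5.9 — the module theory)

Topic `Algebra/Module`; namespace `Literature.Algebra.Module` (sequel to `TorsionHomCountingDVR.lean`,
`TorsionPairingDualityDVR.lean`, `LagrangianSubmodulesSplitPairing.lean` (§1–§2: the setting, `A ∩ V_f` =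
annihilator of `pr_tr(A)`, the two one-sided bookkeeping lemmas), and to x9-p1-w4 g14's
`SymplecticTorsionModulesDVR.lean`, whose symplectic structure theorem
`exists_linearEquiv_quotient_pow_prod_self_of_isAlt_of_span_pair` is the engine of §3).
THEOREMS ONLY: no definition, no named fact, no instance, no `sorry`. Cell `pub/bsd-print-x9`, print leaf G87
`Literature.NumberTheory.GaloisCohomology.Howard2004.thm161_dvrKolyvaginBound` (Howard 2004 Thm. 1.6.1) ⟸
Lemma 1.6.4 ⟸ §1.5; this file is the module theory of Lemmas 1.5.7–1.5.8 and Prop. 1.5.9. The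
Galois-cohomological inputs are HYPOTHESES here, in the shape the source prints them: the maximal isotropy
«`A = A^⟂`» of the image `A` of `𝓗^ℓ(n)` in `H¹(K_ℓ, T)` (Lemma 1.5.6 = global duality + reciprocity), the
splitting `H¹(K_ℓ,T) = H¹_f ⊕ H¹_tr` into free rank-two isotropic summands (Prop. «locally free», H.4 at `ℓ`,
arXiv p0009 L105–108), and the identifications `loc_ℓ 𝓗(n) = A ∩ H¹_f`, `loc_ℓ 𝓗(nℓ) = A ∩ H¹_tr`
(definitions of `𝓕(n)`, `𝓕(nℓ)` at `ℓ`).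

SOURCE, verbatim. B. Howard, *The Heegner point Kolyvagin system*, Compositio Math. **140** (2004) 1439–1472
(= arXiv:1202.6340 §2.5, held text). Lemma 1.5.7 (p0010 L105–L139): «For some `δ ≥ 0`,
`𝓗^ℓ(n)/(𝓗(n)+𝓗(ℓn)) ≅ (R/𝔪^δ)²`. *Proof.* We first construct a non-degenerate, alternating, `R`-bilinear,
`R`-valued pairing on the module `𝓗^ℓ(n)/(𝓗(n)+𝓗(ℓn))`. Let `A` be the local image of `𝓗^ℓ(n)` in
`H¹(K_ℓ,T)`. `A` is maximal isotropic by the previous lemma. Write `A_f` and `A_tr` for the intersections of `A`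
with `H¹_f(K_ℓ,T)` and `H¹_tr(K_ℓ,T)`, respectively. Localization at `ℓ` gives an isomorphism
`𝓗^ℓ(n)/(𝓗(n)+𝓗(ℓn)) ≅ A/(A_f+A_tr)` […] For `x, y ∈ A` we define the symbol `[x,y] ∈ R` by
`[x,y] = ⟨x_f, y_tr⟩`. That `[x,y] = −[y,x]` follows immediately from `⟨x,y⟩ = 0` and the isotropy of the finite
and transverse submodules. Suppose `x ∈ A` is in the kernel of this pairing, then `0 = ⟨x_f,y_tr⟩ = ⟨x_f,y⟩`
for every `y ∈ A` and so `x_f ∈ A` by maximal isotropy of `A`. It follows that `x_tr ∈ A` and so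
`x ∈ A_f + A_tr` […] can be generated by two elements. Therefore `D` is cyclic.» Lemma 1.5.8 (p0010
L142–L154): «There are `a`, `b`, and `δ` greater than or equal to zero such that in the following diagram the
cokernel of each inclusion is a direct sum of two cyclic `R`-modules of the indicated lengths.» Prop. 1.5.9
(p0010 L156 – p0011 L13): «`loc_ℓ(Stub(n)) = 0 ⟹ loc_ℓ(Stub(ℓn)) = 0`. *Proof.* […] `loc_ℓ(Stub(n)) = 0`
implies that `𝔪^{λ(n)}` kills the lower left quotient, and so `a, b ≤ λ(n)`. The diagram immediately implies
`λ(nℓ) = λ(n)+k−a−b−δ ≥ k−a−δ, k−b−δ` so that `𝔪^{λ(nℓ)}` kills the lower right quotient.» Here `R` is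
principal Artinian of length `k` = `R/(ϖᵏ)` for a DVR `(R, ϖ)`, and «`R`-valued» = `R/(ϖᵏ)`-valued.

SETTING (all hypotheses explicit; `R` a DVR, `hϖ : Irreducible ϖ`): an `R`-module `V` with complementary
submodules `V_f`, `V_tr` (`hc : IsCompl Vf Vtr`), each `≃ₗ[R] (Fin 2 → R ⧸ span{ϖᵏ})` (`ef`, `etr`); an
`R`-bilinear SYMMETRIC form `B : V →ₗ V →ₗ P` (`hsymm`), values in `P` with cyclic `ϖ`-torsion (`hP`, e.g.
`P = R/(ϖᵏ)`), NON-DEGENERATE (`hnd : ∀ x, (∀ y, B x y = 0) → x = 0`), `V_f` and `V_tr` ISOTROPIC (`hf`,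
`htr`); `2 ∈ R^×` (`h2`, i.e. `p` odd — needed for `[a,a] = 0`); a submodule `A ≤ V` with
`hA : ∀ x, x ∈ A ↔ ∀ a ∈ A, B x a = 0` («`A = A^⟂`»). Notation: `pr_tr = Vtr.projectionOnto Vf hc.symm`,
`pr_tr(A) = A.map pr_tr ≤ V_tr`, `A ∩ V_tr` either as `A ⊓ Vtr ≤ V` or as `A.comap Vtr.subtype ≤ V_tr`.

WHAT IS PROVED (§1–§2 are in the prequel):
* §3 **`exists_comap_le_pow_smul_map_and_length_eq`** — LEMMA 1.5.7's pairing and LEMMA 1.5.8's `δ`: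
  `∃ δ ≤ k, A ∩ V_tr ≤ ϖ^δ · pr_tr(A) ∧ ℓ(pr_tr(A)) = ℓ(A ∩ V_tr) + 2δ` (the form `[a,b] = ⟨a_f, b⟩` on `A`
  is alternating with radical `(A ∩ V_f) ⊕ (A ∩ V_tr)`, the quotient is two-generated, hence
  `≅ (R/(ϖ^δ))²`; and a surjective endomorphism of `(R/(ϖ^δ))²` is injective).
* §4 **`forall_pow_smul_eq_zero_of_lagrangian`** — PROPOSITION 1.5.9's TRANSFER:
  `ϖ^λ (A ∩ V_f) = 0 → 2λ' + ℓ(A ∩ V_f) = 2λ + ℓ(A ∩ V_tr) → ϖ^{λ'} (A ∩ V_tr) = 0`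
  (and `pow_smul_inf_eq_bot_of_lagrangian`, the same in `ϖ^λ • (–) = ⊥` currency).
  (The second hypothesis is the count `2(λ(nℓ) − λ(n)) = ℓ(𝓗(nℓ)) − ℓ(𝓗(n))` from
  `𝓗(m) ≅ R^ε ⊕ M(m)²`, `ε` independent of `m` — Thm. 1.4.2 / Prop. 1.5.5 — read through the two
  localisation sequences with common kernel `𝓗_ℓ(n)`; it is supplied by the consumer.)

DICTIONARY for the consumer (Howard p0010): `V = H¹(K_ℓ, T^{(k)})`, `V_f = H¹_f(K_ℓ,T)`,
`V_tr = H¹_tr(K_ℓ,T)`, `⟨ , ⟩` = the local Tate pairing of H.4 (symmetric by «flippity», p0009 L66–L73),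
`A = loc_ℓ 𝓗^ℓ(n)`, `A ∩ V_f = loc_ℓ 𝓗(n)`, `A ∩ V_tr = loc_ℓ 𝓗(nℓ)`, `pr_tr(A) ≅ 𝓗^ℓ(n)/𝓗(n)`,
`λ = λ(n)`, `λ' = λ(nℓ)`; the conclusion is `loc_ℓ(Stub(nℓ)) = 0`.

NOT HERE: Lemma 1.5.6 itself (global duality), Lemma 1.5.3 / Prop. 1.5.5 (parity; x10b-p1-w5's
`IsotropicLineParity.lean`), the localisation identifications (x9-p1-w3 g14), the induction of Lemma 1.6.4
(x10b-p1-w2 g15's engine, whose input `h159` this transfer feeds); `thm161_dvrKolyvaginBound` is NOT proved by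
this file. References: [Howard2004HeegnerKolyvagin] §1.5.
-/

noncomputable section

open Module Submodule
open scoped Pointwise

namespace Literature.Algebra.Module

universe u v w

section Lagrangian

variable {R : Type u} [CommRing R] [IsDomain R] [IsDiscreteValuationRing R] {ϖ : R}
variable {V : Type v} [AddCommGroup V] [Module R V]
variable {P : Type w} [AddCommGroup P] [Module R P]

/-! ### §3 Howard's pairing `[x, y] = ⟨x_f, y_tr⟩` and the invariant `δ` (Lemma 1.5.7 / Lemma 1.5.8) -/

/-- **Lemma 1.5.7 (pairing step) and the `δ` of Lemma 1.5.8.** Let `A = A^⟂` be a Lagrangian submodule of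
`V = V_f ⊕ V_tr` (both `≅ (R/(ϖᵏ))²` and isotropic, `⟨ , ⟩` symmetric non-degenerate with values in `P` with
cyclic `ϖ`-torsion, `2 ∈ R^×`). Then for some `δ ≤ k`: `A ∩ V_tr ≤ ϖ^δ · pr_tr(A)` and
`ℓ(pr_tr(A)) = ℓ(A ∩ V_tr) + 2δ` — i.e. `pr_tr(A)/(A ∩ V_tr) ≅ 𝓗^ℓ(n)/(𝓗(n) + 𝓗(ℓn)) ≅ (R/𝔪^δ)²`. Proof
as printed: on `A` the form `[a, b] = ⟨a_f, b⟩ = ⟨a_f, b_tr⟩` is alternating («That `[x,y] = −[y,x]` follows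
immediately from `⟨x,y⟩ = 0` and the isotropy of the finite and transverse submodules»; `[a,a] = 0` uses
`2 ∈ R^×`), its radical is exactly `(A ∩ V_f) + (A ∩ V_tr)` («Suppose `x ∈ A` is in the kernel of this pairing,
then `0 = ⟨x_f, y_tr⟩ = ⟨x_f, y⟩` for every `y ∈ A` and so `x_f ∈ A` by maximal isotropy of `A`. It follows
that `x_tr ∈ A`»), the quotient is generated by two elements (`exists_eq_span_pair`), so it is `≅ (R/(ϖ^δ))²`
by the symplectic structure theorem `exists_linearEquiv_quotient_pow_prod_self_of_isAlt_of_span_pair`; then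
`A ∩ V_tr = ϖ^δ · pr_tr(A)` because a surjective endomorphism of `(R/(ϖ^δ))²` is injective.
[cite: Howard2004HeegnerKolyvagin, Lemma 1.5.7 and Lemma 1.5.8 (arXiv:1202.6340 Lemma 2.5.7, p0010 L105–L139; Lemma 2.5.8, p0010 L142–L154)] -/
theorem exists_comap_le_pow_smul_map_and_length_eq (hϖ : Irreducible ϖ) {k : ℕ}
    (hP : ∀ p q : P, ϖ • p = 0 → ϖ • q = 0 → p ≠ 0 → ∃ r : R, q = r • p)
    (B : V →ₗ[R] V →ₗ[R] P) (hsymm : ∀ x y, B x y = B y x)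
    {Vf Vtr : Submodule R V} (hc : IsCompl Vf Vtr) (ef : ↥Vf ≃ₗ[R] (Fin 2 → R ⧸ Ideal.span {ϖ ^ k}))
    (etr : ↥Vtr ≃ₗ[R] (Fin 2 → R ⧸ Ideal.span {ϖ ^ k})) (hf : ∀ x ∈ Vf, ∀ y ∈ Vf, B x y = 0)
    (htr : ∀ x ∈ Vtr, ∀ y ∈ Vtr, B x y = 0) (h2 : IsUnit (2 : R))
    (A : Submodule R V) (hA : ∀ x, x ∈ A ↔ ∀ a ∈ A, B x a = 0) :
    ∃ δ : ℕ, δ ≤ k ∧ A.comap Vtr.subtype ≤ ϖ ^ δ • A.map (Vtr.projectionOnto Vf hc.symm) ∧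
      Module.length R ↥(A.map (Vtr.projectionOnto Vf hc.symm)) =
        Module.length R ↥(A ⊓ Vtr) + 2 * (δ : ℕ∞) := by
  classical
  set πf := Vf.projectionOnto Vtr hc with hπf
  set πtr := Vtr.projectionOnto Vf hc.symm with hπtr
  set X : Submodule R ↥Vtr := A.map πtr with hXdef
  haveI : Module.Finite R ↥Vf := Module.Finite.equiv ef.symm
  haveI : Module.Finite R ↥Vtr := Module.Finite.equiv etr.symm
  haveI : Module.Finite R V := Module.Finite.equiv (Submodule.prodEquivOfIsCompl Vf Vtr hc)
  haveI : Module.Finite R ↥A := Module.Finite.of_injective A.subtype A.injective_subtype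
  have hfk : ∀ f : ↥Vf, ϖ ^ k • f = 0 := uniformizer_pow_smul_eq_zero_of_linearEquiv ef
  have htk : ∀ t : ↥Vtr, ϖ ^ k • t = 0 := uniformizer_pow_smul_eq_zero_of_linearEquiv etr
  have hdecomp : ∀ v : V, (πf v : V) + (πtr v : V) = v := fun v =>
    Submodule.projection_add_projection_eq_self hc v
  have hVk : ∀ v : V, ϖ ^ k • v = 0 := fun v => by
    rw [← hdecomp v, smul_add, ← Submodule.coe_smul, ← Submodule.coe_smul, hfk, htk,
      Submodule.coe_zero, Submodule.coe_zero, add_zero]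
  -- Howard's form on `A`: `[a, b] = ⟨a_f, b⟩`
  let βA : ↥A →ₗ[R] ↥A →ₗ[R] P := (B ∘ₗ (Vf.subtype ∘ₗ πf ∘ₗ A.subtype)).domRestrict₂ A
  have hβA : ∀ a b : ↥A, βA a b = B (πf a : V) b := fun a b => rfl
  have hskew : ∀ a b : ↥A, βA a b + βA b a = 0 := by
    intro a b
    have hab : B (a : V) b = 0 := (hA a).mp a.2 b b.2
    have e1 : B (a : V) b = B (πf a : V) (πtr b : V) + B (πtr a : V) (πf b : V) := by
      conv_lhs => rw [← hdecomp (a : V)]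
      rw [map_add, LinearMap.add_apply, apply_eq_apply_projection_add B hc (πf a : V) b,
        apply_eq_apply_projection_add B hc (πtr a : V) b, hf _ (πf a).2 _ (πf b).2,
        htr _ (πtr a).2 _ (πtr b).2, zero_add, add_zero]
    have e2 : B (πf a : V) b = B (πf a : V) (πtr b : V) := by
      rw [apply_eq_apply_projection_add B hc (πf a : V) b, hf _ (πf a).2 _ (πf b).2, zero_add]
    have e3 : B (πf b : V) a = B (πtr a : V) (πf b : V) := by
      rw [apply_eq_apply_projection_add B hc (πf b : V) a, hf _ (πf b).2 _ (πf a).2, zero_add, hsymm]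
    rw [hβA, hβA, e2, e3, ← e1, hab]
  have halt : ∀ a : ↥A, βA a a = 0 := fun a => by
    have h := hskew a a
    rw [← two_smul R] at h
    exact h2.smul_eq_zero.mp h
  -- the radical
  set K : Submodule R ↥A := LinearMap.ker βA with hKdef
  have hKer : ∀ a : ↥A, a ∈ K ↔ ∀ b : ↥A, βA a b = 0 := fun a => by
    rw [hKdef, LinearMap.mem_ker]
    constructor
    · intro h b
      rw [h, LinearMap.zero_apply]
    · intro h
      ext b
      exact h b
  have hK_iff : ∀ a : ↥A, a ∈ K ↔ ((πf a : ↥Vf) : V) ∈ A := fun a => by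
    rw [hKer, hA]
    constructor
    · intro h b hb
      rw [← hβA a ⟨b, hb⟩]
      exact h ⟨b, hb⟩
    · intro h b
      rw [hβA]
      exact h b b.2
  have hKof : ∀ d : ↥A, πtr (d : V) = 0 → d ∈ K := fun d hd => by
    rw [hK_iff]
    have hdVf : (d : V) ∈ Vf := (Submodule.projectionOnto_apply_eq_zero_iff hc.symm).mp hd
    rw [Submodule.projectionOnto_apply_of_mem_left hc hdVf]
    exact d.2
  -- the induced non-degenerate alternating form on `A/K`
  have hKle : ∀ a : ↥A, K ≤ LinearMap.ker (βA a) := fun a b hb => by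
    rw [LinearMap.mem_ker]
    have h1 : βA b a = 0 := (hKer b).mp hb a
    have h2 := hskew a b
    rwa [h1, add_zero] at h2
  let β₁ : ↥A →ₗ[R] (↥A ⧸ K) →ₗ[R] P :=
    { toFun := fun a => K.liftQ (βA a) (hKle a)
      map_add' := fun a a' => by
        apply Submodule.linearMap_qext
        rw [Submodule.liftQ_mkQ, LinearMap.add_comp, Submodule.liftQ_mkQ, Submodule.liftQ_mkQ, map_add]
      map_smul' := fun r a => by
        apply Submodule.linearMap_qext
        rw [Submodule.liftQ_mkQ, RingHom.id_apply, LinearMap.smul_comp, Submodule.liftQ_mkQ, map_smul] }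
  have hβ₁ : ∀ a b : ↥A, β₁ a (Submodule.Quotient.mk b) = βA a b := fun a b =>
    Submodule.liftQ_apply _ _ _
  have hβ₁K : K ≤ LinearMap.ker β₁ := fun a ha => by
    rw [LinearMap.mem_ker]
    apply Submodule.linearMap_qext
    ext b
    rw [LinearMap.comp_apply, Submodule.mkQ_apply, hβ₁, (hKer a).mp ha b, LinearMap.zero_comp,
      LinearMap.zero_apply]
  let Bbar : (↥A ⧸ K) →ₗ[R] (↥A ⧸ K) →ₗ[R] P := K.liftQ β₁ hβ₁K
  have hBbar : ∀ a b : ↥A, Bbar (Submodule.Quotient.mk a) (Submodule.Quotient.mk b) = βA a b :=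
    fun a b => by
      change (K.liftQ β₁ hβ₁K (Submodule.Quotient.mk a)) (Submodule.Quotient.mk b) = _
      rw [Submodule.liftQ_apply, hβ₁]
  have halt' : ∀ x, Bbar x x = 0 := fun x => by
    obtain ⟨a, rfl⟩ := Submodule.Quotient.mk_surjective K x
    rw [hBbar]
    exact halt a
  have hnd' : ∀ y, (∀ x, Bbar x y = 0) → y = 0 := fun y hy => by
    obtain ⟨b, rfl⟩ := Submodule.Quotient.mk_surjective K y
    rw [Submodule.Quotient.mk_eq_zero, hKer]
    intro a
    have h1 : βA a b = 0 := by
      rw [← hBbar]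
      exact hy _
    have h2 := hskew a b
    rwa [h1, zero_add] at h2
  have hAk : ∀ x : ↥A ⧸ K, ϖ ^ k • x = 0 := fun x => by
    obtain ⟨a, rfl⟩ := Submodule.Quotient.mk_surjective K x
    have : ϖ ^ k • a = 0 := Subtype.ext (by rw [Submodule.coe_smul, Submodule.coe_zero]; exact hVk a)
    rw [← Submodule.Quotient.mk_smul, this, Submodule.Quotient.mk_zero]
  -- two generators
  obtain ⟨x₁, hx₁, x₂, hx₂, hXeq⟩ := exists_eq_span_pair etr X
  obtain ⟨a₁, ha₁, rfl⟩ := Submodule.mem_map.mp hx₁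
  obtain ⟨a₂, ha₂, rfl⟩ := Submodule.mem_map.mp hx₂
  set ā₁ : ↥A ⧸ K := Submodule.Quotient.mk ⟨a₁, ha₁⟩ with hā₁
  set ā₂ : ↥A ⧸ K := Submodule.Quotient.mk ⟨a₂, ha₂⟩ with hā₂
  -- every `a ∈ A` is `r a₁ + s a₂` modulo `K`
  have hcoef : ∀ a : ↥A, ∀ r s : R, r • πtr a₁ + s • πtr a₂ = πtr (a : V) →
      Submodule.Quotient.mk (p := K) a = r • ā₁ + s • ā₂ := by
    intro a r s hrs
    have hd : (a - r • ⟨a₁, ha₁⟩ - s • ⟨a₂, ha₂⟩ : ↥A) ∈ K := by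
      apply hKof
      rw [Submodule.coe_sub, Submodule.coe_sub, Submodule.coe_smul, Submodule.coe_smul, map_sub, map_sub,
        map_smul, map_smul, ← hrs]
      abel
    have := (Submodule.Quotient.mk_eq_zero K).mpr hd
    rw [Submodule.Quotient.mk_sub, Submodule.Quotient.mk_sub, Submodule.Quotient.mk_smul,
      Submodule.Quotient.mk_smul, sub_sub, sub_eq_zero] at this
    exact this
  have hgen : Submodule.span R {ā₁, ā₂} = ⊤ := by
    rw [eq_top_iff]
    rintro x -
    obtain ⟨a, rfl⟩ := Submodule.Quotient.mk_surjective K x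
    have hmem : πtr (a : V) ∈ X := Submodule.mem_map_of_mem a.2
    rw [hXeq, Submodule.mem_span_pair] at hmem
    obtain ⟨r, s, hrs⟩ := hmem
    rw [hcoef a r s hrs, Submodule.mem_span_pair]
    exact ⟨r, s, rfl⟩
  -- the symplectic structure theorem
  obtain ⟨δ, hδk, ⟨eδ⟩⟩ := exists_linearEquiv_quotient_pow_prod_self_of_isAlt_of_span_pair hϖ hAk hP
    Bbar halt' hnd' ā₁ ā₂ hgen
  have hAδ : ∀ x : ↥A ⧸ K, ϖ ^ δ • x = 0 := fun x => by
    apply eδ.injective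
    rw [map_smul, map_zero]
    exact Prod.ext (uniformizer_pow_smul_quotient_eq_zero δ _) (uniformizer_pow_smul_quotient_eq_zero δ _)
  -- `ψ : R² → A/K`, `c ↦ c₀ ā₁ + c₁ ā₂`, and the standard `qδ : R² → (R/(ϖ^δ))²`
  let ψ : (Fin 2 → R) →ₗ[R] (↥A ⧸ K) :=
    (LinearMap.proj 0 : (Fin 2 → R) →ₗ[R] R).smulRight ā₁ + (LinearMap.proj 1 : (Fin 2 → R) →ₗ[R] R).smulRight ā₂
  have hψ : ∀ c : Fin 2 → R, ψ c = c 0 • ā₁ + c 1 • ā₂ := fun c => rfl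
  let qδ : (Fin 2 → R) →ₗ[R] (R ⧸ Ideal.span {ϖ ^ δ}) × (R ⧸ Ideal.span {ϖ ^ δ}) :=
    ((Ideal.span {ϖ ^ δ}).mkQ ∘ₗ LinearMap.proj 0).prod ((Ideal.span {ϖ ^ δ}).mkQ ∘ₗ LinearMap.proj 1)
  have hqδ : ∀ c : Fin 2 → R, qδ c = (Submodule.Quotient.mk (c 0), Submodule.Quotient.mk (c 1)) :=
    fun c => rfl
  have hqδsurj : Function.Surjective qδ := by
    rintro ⟨y₀, y₁⟩
    obtain ⟨r₀, rfl⟩ := Submodule.Quotient.mk_surjective _ y₀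
    obtain ⟨r₁, rfl⟩ := Submodule.Quotient.mk_surjective _ y₁
    exact ⟨![r₀, r₁], by rw [hqδ]; rfl⟩
  have hqδker : ∀ c : Fin 2 → R, qδ c = 0 → ϖ ^ δ ∣ c 0 ∧ ϖ ^ δ ∣ c 1 := fun c hc0 => by
    rw [hqδ, Prod.mk_eq_zero, Submodule.Quotient.mk_eq_zero, Submodule.Quotient.mk_eq_zero] at hc0
    exact ⟨Ideal.mem_span_singleton.mp hc0.1, Ideal.mem_span_singleton.mp hc0.2⟩
  let χ : (Fin 2 → R) →ₗ[R] (R ⧸ Ideal.span {ϖ ^ δ}) × (R ⧸ Ideal.span {ϖ ^ δ}) :=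
    (eδ : (↥A ⧸ K) →ₗ[R] _) ∘ₗ ψ
  have hχ : ∀ c, χ c = eδ (ψ c) := fun c => rfl
  have hψsurj : Function.Surjective ψ := fun x => by
    have hx : x ∈ Submodule.span R {ā₁, ā₂} := by
      rw [hgen]
      trivial
    obtain ⟨r, s, rfl⟩ := Submodule.mem_span_pair.mp hx
    exact ⟨![r, s], by rw [hψ]; rfl⟩
  have hχsurj : Function.Surjective χ := eδ.surjective.comp hψsurj
  have hχker : LinearMap.ker qδ ≤ LinearMap.ker χ := fun c hc0 => by
    rw [LinearMap.mem_ker] at hc0 ⊢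
    obtain ⟨⟨c₀, h₀⟩, ⟨c₁, h₁⟩⟩ := hqδker c hc0
    rw [hχ, hψ, h₀, h₁, mul_smul, mul_smul, ← smul_add, hAδ, map_zero]
  -- the induced endomorphism of `(R/(ϖ^δ))²` is onto, hence injective: `ker χ = ker qδ`
  have hkerχ : ∀ c : Fin 2 → R, χ c = 0 → qδ c = 0 := by
    let χbar : ((R ⧸ Ideal.span {ϖ ^ δ}) × (R ⧸ Ideal.span {ϖ ^ δ})) →ₗ[R]
        ((R ⧸ Ideal.span {ϖ ^ δ}) × (R ⧸ Ideal.span {ϖ ^ δ})) :=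
      ((LinearMap.ker qδ).liftQ χ hχker) ∘ₗ
        ((qδ.quotKerEquivOfSurjective hqδsurj).symm : _ →ₗ[R] ((Fin 2 → R) ⧸ LinearMap.ker qδ))
    have hχbar : ∀ c, χbar (qδ c) = χ c := fun c => by
      have hs : (qδ.quotKerEquivOfSurjective hqδsurj).symm (qδ c) = (LinearMap.ker qδ).mkQ c := by
        rw [LinearEquiv.symm_apply_eq]
        rfl
      change (LinearMap.ker qδ).liftQ χ hχker ((qδ.quotKerEquivOfSurjective hqδsurj).symm (qδ c)) = χ c
      rw [hs, Submodule.mkQ_apply, Submodule.liftQ_apply]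
    have hsurj : Function.Surjective χbar := fun y => by
      obtain ⟨c, rfl⟩ := hχsurj y
      exact ⟨qδ c, hχbar c⟩
    have hinj := IsNoetherian.injective_of_surjective_endomorphism χbar hsurj
    intro c hc0
    have : χbar (qδ c) = 0 := by rw [hχbar, hc0]
    exact (injective_iff_map_eq_zero χbar).mp hinj _ this
  refine ⟨δ, hδk, fun t ht => ?_, ?_⟩
  · -- `A ∩ V_tr ≤ ϖ^δ X`
    have htX : t ∈ X := ⟨t, ht, Submodule.projectionOnto_apply_left hc.symm t⟩
    rw [hXeq, Submodule.mem_span_pair] at htX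
    obtain ⟨r, s, hrs⟩ := htX
    have ht' : πtr ((⟨(t : V), ht⟩ : ↥A) : V) = t := Submodule.projectionOnto_apply_left hc.symm t
    have hK1 : Submodule.Quotient.mk (p := K) (⟨(t : V), ht⟩ : ↥A) = r • ā₁ + s • ā₂ :=
      hcoef _ r s (by rw [hrs, ht'])
    have hK2 : (⟨(t : V), ht⟩ : ↥A) ∈ K := by
      rw [hK_iff]
      have : πf ((⟨(t : V), ht⟩ : ↥A) : V) = 0 := Submodule.projectionOnto_apply_right hc t
      rw [this, Submodule.coe_zero]
      exact A.zero_mem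
    have hψ0 : ψ ![r, s] = 0 := by
      rw [hψ]
      change r • ā₁ + s • ā₂ = 0
      rw [← hK1, Submodule.Quotient.mk_eq_zero]
      exact hK2
    have hχ0 : χ ![r, s] = 0 := by rw [hχ, hψ0, map_zero]
    obtain ⟨⟨r', hr'⟩, ⟨s', hs'⟩⟩ := hqδker _ (hkerχ _ hχ0)
    have hr'' : r = ϖ ^ δ * r' := hr'
    have hs'' : s = ϖ ^ δ * s' := hs'
    rw [← hrs, hr'', hs'', mul_smul, mul_smul, ← smul_add]
    refine Submodule.smul_mem_pointwise_smul _ _ _ ?_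
    rw [hXeq, Submodule.mem_span_pair]
    exact ⟨r', s', rfl⟩
  · -- `ℓ(X) = ℓ(A ∩ V_tr) + 2δ`, by counting `ℓ(A)` in two ways
    have hfinV : Module.length R V ≠ ⊤ := by
      rw [(Submodule.prodEquivOfIsCompl Vf Vtr hc).symm.length_eq, Module.length_prod, ef.length_eq,
        etr.length_eq, Module.length_pi_of_fintype, Finset.sum_const, Finset.card_univ, Fintype.card_fin,
        length_quotient_uniformizer_pow hϖ]
      exact ENat.coe_ne_top _
    -- `g : A → V_tr`, `a ↦ a_tr`: kernel `A ∩ V_f`, image `X`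
    let g : ↥A →ₗ[R] ↥Vtr := πtr ∘ₗ A.subtype
    have hgker : LinearMap.ker g = Vf.comap A.subtype := by
      rw [LinearMap.ker_comp, Submodule.ker_projectionOnto]
    have hgrange : LinearMap.range g = X := by
      rw [LinearMap.range_comp, Submodule.range_subtype]
    have hAf' : Module.length R ↥(Vf.comap A.subtype) = Module.length R ↥(A ⊓ Vf) := by
      have : Vf.comap A.subtype = (Vf ⊓ A).comap A.subtype := by
        rw [Submodule.comap_inf, Submodule.comap_subtype_self, inf_top_eq]
      rw [this, (Submodule.comapSubtypeEquivOfLe (inf_le_right : Vf ⊓ A ≤ A)).length_eq, inf_comm]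
    have hAtr' : Module.length R ↥(Vtr.comap A.subtype) = Module.length R ↥(A ⊓ Vtr) := by
      have : Vtr.comap A.subtype = (Vtr ⊓ A).comap A.subtype := by
        rw [Submodule.comap_inf, Submodule.comap_subtype_self, inf_top_eq]
      rw [this, (Submodule.comapSubtypeEquivOfLe (inf_le_right : Vtr ⊓ A ≤ A)).length_eq, inf_comm]
    have hL1 : Module.length R ↥A = Module.length R ↥(A ⊓ Vf) + Module.length R ↥X := by
      have hex : Function.Exact (LinearMap.ker g).subtype g.rangeRestrict :=
        LinearMap.exact_iff.mpr (by rw [LinearMap.ker_rangeRestrict, Submodule.range_subtype])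
      rw [Module.length_eq_add_of_exact (LinearMap.ker g).subtype g.rangeRestrict (injective_subtype _)
        g.surjective_rangeRestrict hex, hgker, hAf', hgrange]
    -- `K = (A ∩ V_f) ⊕ (A ∩ V_tr)` inside `A`
    have hKeq : K = Vf.comap A.subtype ⊔ Vtr.comap A.subtype := by
      refine le_antisymm (fun a ha => ?_) (sup_le (fun a ha => ?_) (fun a ha => ?_))
      · rw [Submodule.mem_sup]
        have h1 : ((πf a : ↥Vf) : V) ∈ A := (hK_iff a).mp ha
        have h2 : ((πtr a : ↥Vtr) : V) ∈ A := by
          have : ((πtr a : ↥Vtr) : V) = (a : V) - (πf a : V) := eq_sub_of_add_eq' (hdecomp (a : V))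
          rw [this]
          exact A.sub_mem a.2 h1
        refine ⟨⟨_, h1⟩, ?_, ⟨_, h2⟩, ?_, ?_⟩
        · change ((πf a : ↥Vf) : V) ∈ Vf
          exact (πf a).2
        · change ((πtr a : ↥Vtr) : V) ∈ Vtr
          exact (πtr a).2
        · apply Subtype.ext
          change ((πf a : ↥Vf) : V) + ((πtr a : ↥Vtr) : V) = a
          exact hdecomp a
      · have ha' : (a : V) ∈ Vf := ha
        rw [hK_iff, Submodule.projectionOnto_apply_of_mem_left hc ha']
        exact a.2
      · have ha' : (a : V) ∈ Vtr := ha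
        rw [hK_iff, (Submodule.projectionOnto_apply_eq_zero_iff hc).mpr ha', Submodule.coe_zero]
        exact A.zero_mem
    have hKdisj : Vf.comap A.subtype ⊓ Vtr.comap A.subtype = ⊥ := by
      rw [eq_bot_iff]
      rintro a ⟨haf, hatr⟩
      rw [Submodule.mem_bot]
      apply Subtype.ext
      exact (Submodule.disjoint_def.mp hc.disjoint) _ haf hatr
    have hL2 : Module.length R ↥A = Module.length R ↥K + 2 * (δ : ℕ∞) := by
      rw [length_eq_length_submodule_add_length_quotient K, eδ.length_eq, Module.length_prod,
        length_quotient_uniformizer_pow hϖ, two_mul]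
    have hL3 : Module.length R ↥K = Module.length R ↥(A ⊓ Vf) + Module.length R ↥(A ⊓ Vtr) := by
      have h := length_sup_add_length_inf (Vf.comap A.subtype) (Vtr.comap A.subtype)
      rw [hKdisj, Module.length_bot, add_zero, ← hKeq, hAf', hAtr'] at h
      exact h
    have hfinAf : Module.length R ↥(A ⊓ Vf) ≠ ⊤ :=
      ne_top_of_le_ne_top hfinV (Module.length_le_of_injective _ (injective_subtype _))
    have h := hL1
    rw [hL2, hL3, add_assoc] at h
    exact le_antisymm ((ENat.add_le_add_iff_left hfinAf).mp h.symm.le)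
      ((ENat.add_le_add_iff_left hfinAf).mp h.le)

/-! ### §4 Proposition 1.5.9: the transfer `𝔪^{λ(n)}`-kills-`loc 𝓗(n)` ⟹ `𝔪^{λ(nℓ)}`-kills-`loc 𝓗(nℓ)` -/

/-- **Howard's Proposition 1.5.9, module-theoretic core.** In the split setting (`V = V_f ⊕ V_tr`, both
`≅ (R/(ϖᵏ))²` and isotropic for the symmetric non-degenerate `P`-valued `⟨ , ⟩`, `P` with cyclic `ϖ`-torsion,
`2 ∈ R^×`), let `A = A^⟂` («the image of `𝓗^ℓ(n)` in `H¹(K_ℓ,T)` is maximal isotropic», Lemma 1.5.6, taken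
as a hypothesis). If `ϖ^λ (A ∩ V_f) = 0` («`loc_ℓ(Stub(n)) = 0`», `Stub(n) = 𝔪^{λ(n)}𝓗(n)`,
`loc_ℓ 𝓗(n) = A ∩ H¹_f`) and `2λ' + ℓ(A ∩ V_f) = 2λ + ℓ(A ∩ V_tr)` (the count `λ(nℓ) − λ(n) =
(ℓ(𝓗(nℓ)) − ℓ(𝓗(n)))/2` from `𝓗(m) ≅ R^ε ⊕ M(m)²` with `ε` independent of `m`, Prop. 1.5.5, and the common
kernel `𝓗_ℓ(n)` of the two localisations), then `ϖ^{λ'} (A ∩ V_tr) = 0` («`𝔪^{λ(nℓ)}` kills the lower right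
quotient», i.e. `loc_ℓ(Stub(nℓ)) = 0`). Proof: Lemma 1.5.8's bookkeeping — `a, b ≤ λ`
(`pow_smul_top_le_map_projectionOnto`), the dual quotient (`length_inf_le_length_quotient_map_projectionOnto`),
`δ` (`exists_comap_le_pow_smul_map_and_length_eq`) and the colength inequality
(`natCast_add_length_span_singleton_le`).
[cite: Howard2004HeegnerKolyvagin, Prop. 1.5.9 with Lemma 1.5.8 (arXiv:1202.6340 Prop. 2.5.9, p0010 L156 – p0011 L13)] -/
theorem forall_pow_smul_eq_zero_of_lagrangian (hϖ : Irreducible ϖ) {k : ℕ}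
    (hP : ∀ p q : P, ϖ • p = 0 → ϖ • q = 0 → p ≠ 0 → ∃ r : R, q = r • p)
    (B : V →ₗ[R] V →ₗ[R] P) (hsymm : ∀ x y, B x y = B y x) (hnd : ∀ x : V, (∀ y, B x y = 0) → x = 0)
    {Vf Vtr : Submodule R V} (hc : IsCompl Vf Vtr) (ef : ↥Vf ≃ₗ[R] (Fin 2 → R ⧸ Ideal.span {ϖ ^ k}))
    (etr : ↥Vtr ≃ₗ[R] (Fin 2 → R ⧸ Ideal.span {ϖ ^ k})) (hf : ∀ x ∈ Vf, ∀ y ∈ Vf, B x y = 0)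
    (htr : ∀ x ∈ Vtr, ∀ y ∈ Vtr, B x y = 0) (h2 : IsUnit (2 : R))
    (A : Submodule R V) (hA : ∀ x, x ∈ A ↔ ∀ a ∈ A, B x a = 0) {lam lam' : ℕ}
    (hlam : ∀ a ∈ A ⊓ Vf, ϖ ^ lam • a = 0)
    (hlen : 2 * (lam' : ℕ∞) + Module.length R ↥(A ⊓ Vf) = 2 * (lam : ℕ∞) + Module.length R ↥(A ⊓ Vtr)) :
    ∀ a ∈ A ⊓ Vtr, ϖ ^ lam' • a = 0 := by
  obtain ⟨δ, -, hY, hlenX⟩ :=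
    exists_comap_le_pow_smul_map_and_length_eq hϖ hP B hsymm hc ef etr hf htr h2 A hA
  haveI : Module.Finite R ↥Vtr := Module.Finite.equiv etr.symm
  have htk : ∀ t : ↥Vtr, ϖ ^ k • t = 0 := uniformizer_pow_smul_eq_zero_of_linearEquiv etr
  have hj : ϖ ^ lam • (⊤ : Submodule R ↥Vtr) ≤ A.map (Vtr.projectionOnto Vf hc.symm) :=
    pow_smul_top_le_map_projectionOnto hϖ hP B hnd hc ef etr hf htr A hA hlam
  have hb := length_inf_le_length_quotient_map_projectionOnto hϖ hP B hnd hc etr hf A hA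
  have hq : Module.length R ↥(A.map (Vtr.projectionOnto Vf hc.symm)) +
      Module.length R (↥Vtr ⧸ A.map (Vtr.projectionOnto Vf hc.symm)) = 2 * (k : ℕ∞) := by
    rw [← length_eq_length_submodule_add_length_quotient, etr.length_eq, Module.length_pi_of_fintype,
      Finset.sum_const, Finset.card_univ, Fintype.card_fin, length_quotient_uniformizer_pow hϖ, two_mul,
      two_nsmul]
  intro a ha
  have haX : (⟨a, ha.2⟩ : ↥Vtr) ∈ ϖ ^ δ • A.map (Vtr.projectionOnto Vf hc.symm) :=
    hY (show (⟨a, ha.2⟩ : ↥Vtr) ∈ A.comap Vtr.subtype from ha.1)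
  obtain ⟨x, hxX, hxa⟩ := (Submodule.mem_smul_pointwise_iff_exists _ _ _).mp haX
  obtain ⟨m, hm, hmx⟩ := exists_length_span_singleton_eq_and_pow_smul_eq_zero hϖ (htk x)
  have hd := natCast_add_length_span_singleton_le hϖ etr _ hj hxX
  rw [hm] at hd
  -- all lengths are finite: pass to `ℕ`
  have hfin2k : (2 * (k : ℕ∞)) ≠ ⊤ := by
    rw [← Nat.cast_two, ← Nat.cast_mul]
    exact ENat.coe_ne_top _
  obtain ⟨nX, hnX⟩ := ENat.ne_top_iff_exists.mp (ne_top_of_le_ne_top hfin2k (hq ▸ le_self_add))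
  obtain ⟨nq, hnq⟩ := ENat.ne_top_iff_exists.mp (ne_top_of_le_ne_top hfin2k (hq ▸ le_add_self))
  obtain ⟨nf, hnf⟩ := ENat.ne_top_iff_exists.mp (ne_top_of_le_ne_top (hnq ▸ ENat.coe_ne_top nq) hb)
  obtain ⟨nt, hnt⟩ := ENat.ne_top_iff_exists.mp
    (ne_top_of_le_ne_top (hnX ▸ ENat.coe_ne_top nX) (hlenX ▸ le_self_add))
  rw [← hnX, ← hnq] at hq
  rw [← hnX] at hd
  rw [← hnf, ← hnq] at hb
  rw [← hnX, ← hnt] at hlenX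
  rw [← hnf, ← hnt] at hlen
  norm_cast at hq hd hb hlenX hlen
  have hle : m ≤ lam' + δ := by omega
  have : ϖ ^ lam' • (⟨a, ha.2⟩ : ↥Vtr) = 0 := by
    rw [← hxa, smul_smul, ← pow_add, ← pow_sub_mul_pow ϖ hle, mul_smul, hmx, smul_zero]
  simpa using congrArg Subtype.val this

/-- **Prop. 1.5.9's transfer in `ϖ^λ • (–) = ⊥` currency** (the shape of x9-p1-w3's
`Submodule.smul_le_ker_iff_smul_map_eq_bot`): `ϖ^λ • (A ∩ V_f) = ⊥ → 2λ' + ℓ(A ∩ V_f) = 2λ + ℓ(A ∩ V_tr) →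
ϖ^{λ'} • (A ∩ V_tr) = ⊥`. [cite: Howard2004HeegnerKolyvagin, Prop. 1.5.9 (arXiv:1202.6340 Prop. 2.5.9, p0010 L156 – p0011 L13)] -/
theorem pow_smul_inf_eq_bot_of_lagrangian (hϖ : Irreducible ϖ) {k : ℕ}
    (hP : ∀ p q : P, ϖ • p = 0 → ϖ • q = 0 → p ≠ 0 → ∃ r : R, q = r • p)
    (B : V →ₗ[R] V →ₗ[R] P) (hsymm : ∀ x y, B x y = B y x) (hnd : ∀ x : V, (∀ y, B x y = 0) → x = 0)
    {Vf Vtr : Submodule R V} (hc : IsCompl Vf Vtr) (ef : ↥Vf ≃ₗ[R] (Fin 2 → R ⧸ Ideal.span {ϖ ^ k}))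
    (etr : ↥Vtr ≃ₗ[R] (Fin 2 → R ⧸ Ideal.span {ϖ ^ k})) (hf : ∀ x ∈ Vf, ∀ y ∈ Vf, B x y = 0)
    (htr : ∀ x ∈ Vtr, ∀ y ∈ Vtr, B x y = 0) (h2 : IsUnit (2 : R))
    (A : Submodule R V) (hA : ∀ x, x ∈ A ↔ ∀ a ∈ A, B x a = 0) {lam lam' : ℕ}
    (hlam : ϖ ^ lam • (A ⊓ Vf) = ⊥)
    (hlen : 2 * (lam' : ℕ∞) + Module.length R ↥(A ⊓ Vf) = 2 * (lam : ℕ∞) + Module.length R ↥(A ⊓ Vtr)) :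
    ϖ ^ lam' • (A ⊓ Vtr) = ⊥ := by
  rw [eq_bot_iff]
  intro y hy
  obtain ⟨a, ha, rfl⟩ := (Submodule.mem_smul_pointwise_iff_exists _ _ _).mp hy
  rw [Submodule.mem_bot]
  refine forall_pow_smul_eq_zero_of_lagrangian hϖ hP B hsymm hnd hc ef etr hf htr h2 A hA
    (fun b hb => ?_) hlen a ha
  have hmem : ϖ ^ lam • b ∈ ϖ ^ lam • (A ⊓ Vf) := Submodule.smul_mem_pointwise_smul _ _ _ hb
  rw [hlam, Submodule.mem_bot] at hmem
  exact hmem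

end Lagrangian

end Literature.Algebra.Module
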